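import Summits.QuantumFields.BalabanUV.T4Continuum.Support.DirichletDirectionalBesov

/-!
# `BalabanUV.T4Continuum.Support.DirichletDirectionalBesovCutoff` — NE2 (node U1a) formalisation swarm, SUPPLIER item «Δ1-BESOV»
# under the owner's sub-row `T4-U1a.S-NE2-D1-DIRICHLET°` (wall `hinj`): module (I) file 2 of 2 — THE SMOOTH DIRECTIONAL CUTOFFS
# (hypothesis STRUCTURE `AdmissibleCutoff`), THE LAPLACIAN PRODUCT RULE ∕ COMMUTATOR BOUND, and THE END: DIRECTIONAL `H^{3/2}`
# (BESOV) REGULARITY UP TO THE BOUNDARY (unit b2b-balaban-t4-ne2-formalise-leaf-08, gen 3, v1)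

HONEST FRAMING.  Rung (B)+1 bookkeeping at MODEL level (U = 1, scalar lattice Laplacian), finite torus; NE2 (U1a) is NOT proved by this
file; spine PROVED 0/9 unchanged; NOT infinite volume, NOT the mass gap, NOT Clay.  HONEST DEPENDENCY (verbatim): «continuum YM on T⁴ ⇐
BetaPertH ∧ nine spine estimates (0/9 proved); BetaPertH ⇐ (D1) ∧ (D4) ∧ CAP+tail; G-an2-4 gates asym, D1 and NE2/3/4.»

File 1 (`DirichletDirectionalBesov`) proved the one-sided Nirenberg identity `Σ_ν‖∂_ν(T_vw − w)‖² = −2Re⟨T_vw − w, Δw⟩` and the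
MAIN LEMMA `nsq_sdiff_sdiff_le_of_admissible`: if `T_{±e_μ}w − w` is supported in `Ω` and `r = Δw` on `Ω` then
`‖∂_μ∂_μw‖² ≤ 2‖c‖·√E(w)·‖r‖`.  THIS FILE arranges admissibility by smooth cutoffs and concludes:

 * §4 the cut field `cut ψ z = ψ·z`; the hypothesis STRUCTURE **`AdmissibleCutoff Ω μ ψ ℓ₁ ℓ₂`** (`0 ≤ ψ ≤ 1`, first differences
   `≤ ℓ₁`, PURE second differences `≤ ℓ₂`, `ψ = 0` at the sites of `Ω` whose `−μ`-neighbour is outside, `ψ = 1` at those whose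
   `+μ`-neighbour is outside; the complement `1 − ψ` mirrors it); the product rules `∂_ν(ψz) = (T_{e_ν}ψ)∂_νz + c(T_{e_ν}ψ − ψ)z`
   (so **`energy_cut_le`**: `E(ψz) ≤ 2E(z) + 2d‖c‖²ℓ₁²‖z‖²`) and **`LapS_cut`**:
   `Δ(ψz) = ψΔz + Σ_ν|c|²[(ψ − T_{e_ν}ψ)(T_{e_ν}z − T_{−e_ν}z) + (2ψ − T_{e_ν}ψ − T_{−e_ν}ψ)T_{−e_ν}z]` — first and PURE second
   differences of `ψ` only — hence the commutator bound **`sqrt_nsq_restrict_LapS_cut_le`**: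
   `‖1_ΩΔ(ψz)‖ ≤ ‖1_ΩΔz‖ + Σ_ν(2‖c‖ℓ₁‖∂_νz‖ + ‖c‖²ℓ₂‖z‖)`;
 * §5 admissibility: `T_{+e_μ}(ψz) − ψz` and `T_{−e_μ}((1−ψ)z) − (1−ψ)z` vanish off `Ω` for every `z` supported in `Ω`;
 * §6 **THE END `nsq_sdiff_sdiff_le`** (and its adjoint-sandwich twin **`nsq_sdiffH_sdiff_le`**, the form (C-glob) consumes): for EVERY
   `z` supported in `Ω` and every axis `μ` carrying an admissible cutoff,
   `‖∂_μ∂_μ z‖² ≤ 8‖c‖·√(2E(z) + 2d‖c‖²ℓ₁²‖z‖²)·( √(Σ_{x∈Ω}|(Δz)(x)|²) + Σ_ν(2‖c‖ℓ₁‖∂_νz‖ + ‖c‖²ℓ₂‖z‖) )`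
   — with `ℓ₁ ~ c⁻¹`, `ℓ₂ ~ c⁻²` (unit-scale cutoffs, module (II) `DirichletMonotoneCutoff` for LOCALLY MONOTONE unions of unit blocks)
   the right side is `O(c)·(E + ‖z‖² + ‖1_ΩΔz‖²)`: ONE power of `c` worse than `H²`, no convexity — fed into gan24-p2's (C-glob) it gives
   the Dirichlet two-level law at the geometric rate `√R/√N` (module (III) `DirichletMonotoneTwoLevel`).

ABSOLUTE RULE (cell, verbatim): «No internally-minted statement may enter as a cited fact. Every hypothesis is either kernel-proved in
this package or a verbatim quotation of a PUBLISHED theorem with page reference. The manuscript(s) under audit are NOT citable for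
their own disputed steps — they are the thing under adjudication; programme-internal (2001/route/tribunal) claims are never citable.»
[folklore] finite lattice calculus; the only predicate is the parametrised hypothesis SHAPE `AdmissibleCutoff` (no `def … : Prop` fact).
NOT CLAIMED: that every region admits such cutoffs; the vector `calDalev`; rate `L^{−k}`; NE2; NE3; «not in print; our proof».
-/

noncomputable section

open scoped BigOperators ComplexConjugate Matrix
open Finset

namespace Summit.QuantumFields.BalabanUV.T4Continuum.DirichletDirectionalBesovCutoff

open Literature.MathematicalPhysics.QuantumFieldTheory.Balaban1983to89.B5Prop11Plancherel (Tor unitVec)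
open Literature.MathematicalPhysics.QuantumFieldTheory.Balaban1983to89.B5Action121 (sdiff LapS sdiff_mulVec LapS_mulVec)
open Literature.MathematicalPhysics.QuantumFieldTheory.Balaban1983to89.B5Prop11Lower (nsq nsq_nonneg)
open Summit.QuantumFields.BalabanUV.T4Continuum.ScalarBlockPoincare (nsq_add_le nsq_smul transS nsq_transS)
open Summit.QuantumFields.BalabanUV.T4Continuum.DirichletDirectionalBesov

variable {d : ℕ}

section Torus

variable (N : Fin d → ℕ) [hN : ∀ μ, NeZero (N μ)]

/-! ## §4 Smooth directional cutoffs: the hypothesis STRUCTURE and the product rule -/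

/-- the cut field `(ψz)(x) = ψ(x)·z(x)` for a real cutoff `ψ`. [folklore] -/
def cut (ψ : Tor N → ℝ) (z : Tor N → ℂ) : Tor N → ℂ := fun x => (ψ x : ℂ) * z x

/-- [shape] **ADMISSIBLE `μ`-CUTOFF for the region `Ω`** (hypothesis STRUCTURE on data, no fact): a real lattice function `ψ` with
`0 ≤ ψ ≤ 1`, first differences `≤ ℓ₁` and PURE second differences `≤ ℓ₂` along every axis (smooth on the scale `ℓ₁⁻¹`), vanishing at the
sites of `Ω` whose `−μ`-neighbour is outside `Ω` and equal to `1` at the sites of `Ω` whose `+μ`-neighbour is outside `Ω` (so that `ψz`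
may be translated by `+e_μ` and `(1−ψ)z` by `−e_μ` WITHOUT LEAVING `Ω`, for every `z` supported in `Ω`). [folklore] -/
structure AdmissibleCutoff (Ω : Tor N → Prop) (μ : Fin d) (ψ : Tor N → ℝ) (ℓ₁ ℓ₂ : ℝ) : Prop where
  nonneg : ∀ x, 0 ≤ ψ x
  le_one : ∀ x, ψ x ≤ 1
  lip : ∀ x (ν : Fin d), |ψ (x + unitVec N ν) - ψ x| ≤ ℓ₁
  lip₂ : ∀ x (ν : Fin d), |2 * ψ x - ψ (x + unitVec N ν) - ψ (x - unitVec N ν)| ≤ ℓ₂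
  zero_of : ∀ x, Ω x → ¬ Ω (x - unitVec N μ) → ψ x = 0
  one_of : ∀ x, Ω x → ¬ Ω (x + unitVec N μ) → ψ x = 1

namespace AdmissibleCutoff

variable {N} {Ω : Tor N → Prop} {μ : Fin d} {ψ : Tor N → ℝ} {ℓ₁ ℓ₂ : ℝ}

omit hN in
/-- `ℓ₁ ≥ 0` (when `d ≥ 1`; stated with a witness direction). [folklore] -/
theorem ell1_nonneg (h : AdmissibleCutoff N Ω μ ψ ℓ₁ ℓ₂) (x : Tor N) : 0 ≤ ℓ₁ := (abs_nonneg _).trans (h.lip x μ)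

omit hN in
/-- `ℓ₂ ≥ 0`. [folklore] -/
theorem ell2_nonneg (h : AdmissibleCutoff N Ω μ ψ ℓ₁ ℓ₂) (x : Tor N) : 0 ≤ ℓ₂ := (abs_nonneg _).trans (h.lip₂ x μ)

omit hN in
/-- the COMPLEMENTARY cutoff `1 − ψ` has the same smoothness and the mirrored boundary values. [folklore] -/
theorem compl_bounds (h : AdmissibleCutoff N Ω μ ψ ℓ₁ ℓ₂) :
    (∀ x, 0 ≤ 1 - ψ x) ∧ (∀ x, 1 - ψ x ≤ 1) ∧ (∀ x (ν : Fin d), |(1 - ψ (x + unitVec N ν)) - (1 - ψ x)| ≤ ℓ₁)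
      ∧ (∀ x (ν : Fin d), |2 * (1 - ψ x) - (1 - ψ (x + unitVec N ν)) - (1 - ψ (x - unitVec N ν))| ≤ ℓ₂) := by
  refine ⟨fun x => sub_nonneg.mpr (h.le_one x), fun x => by linarith [h.nonneg x], fun x ν => ?_, fun x ν => ?_⟩
  · rw [show (1 - ψ (x + unitVec N ν)) - (1 - ψ x) = -(ψ (x + unitVec N ν) - ψ x) by ring, abs_neg]; exact h.lip x ν
  · rw [show 2 * (1 - ψ x) - (1 - ψ (x + unitVec N ν)) - (1 - ψ (x - unitVec N ν))
        = -(2 * ψ x - ψ (x + unitVec N ν) - ψ (x - unitVec N ν)) by ring, abs_neg]; exact h.lip₂ x ν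

omit hN in
/-- transport along a pointwise-equivalent region predicate. [folklore] -/
theorem of_iff (h : AdmissibleCutoff N Ω μ ψ ℓ₁ ℓ₂) {Ω' : Tor N → Prop} (hΩ : ∀ x, Ω' x ↔ Ω x) :
    AdmissibleCutoff N Ω' μ ψ ℓ₁ ℓ₂ where
  nonneg := h.nonneg
  le_one := h.le_one
  lip := h.lip
  lip₂ := h.lip₂
  zero_of x hx hx' := h.zero_of x ((hΩ x).1 hx) (fun h' => hx' ((hΩ _).2 h'))
  one_of x hx hx' := h.one_of x ((hΩ x).1 hx) (fun h' => hx' ((hΩ _).2 h'))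

omit hN in
/-- weaken the smoothness constants. [folklore] -/
theorem mono (h : AdmissibleCutoff N Ω μ ψ ℓ₁ ℓ₂) {ℓ₁' ℓ₂' : ℝ} (h1 : ℓ₁ ≤ ℓ₁') (h2 : ℓ₂ ≤ ℓ₂') :
    AdmissibleCutoff N Ω μ ψ ℓ₁' ℓ₂' where
  nonneg := h.nonneg
  le_one := h.le_one
  lip x ν := (h.lip x ν).trans h1
  lip₂ x ν := (h.lip₂ x ν).trans h2
  zero_of := h.zero_of
  one_of := h.one_of

end AdmissibleCutoff

omit hN in
/-- `|ψ| ≤ 1` as a complex multiplier. [folklore] -/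
theorem norm_ofReal_le_one {ψ : Tor N → ℝ} (h0 : ∀ x, 0 ≤ ψ x) (h1 : ∀ x, ψ x ≤ 1) (x : Tor N) : ‖(ψ x : ℂ)‖ ≤ 1 := by
  rw [Complex.norm_real, Real.norm_eq_abs, abs_of_nonneg (h0 x)]; exact h1 x

/-- **the product rule for one difference**: `∂_ν(ψz) = (T_{e_ν}ψ)·∂_νz + c·(T_{e_ν}ψ − ψ)·z`. [folklore] -/
theorem sdiff_cut (c : ℂ) (ν : Fin d) (ψ : Tor N → ℝ) (z : Tor N → ℂ) :
    sdiff N c ν *ᵥ cut N ψ z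
      = cut N (fun x => ψ (x + unitVec N ν)) (sdiff N c ν *ᵥ z)
        + c • (fun x => ((ψ (x + unitVec N ν) - ψ x : ℝ) : ℂ) * z x) := by
  funext x
  simp only [sdiff_mulVec, cut, Pi.add_apply, Pi.smul_apply, smul_eq_mul, Complex.ofReal_sub]
  ring

/-- hence `‖∂_ν(ψz)‖² ≤ 2‖∂_νz‖² + 2‖c‖²ℓ₁²‖z‖²` for `0 ≤ ψ ≤ 1`, `|T_{e_ν}ψ − ψ| ≤ ℓ₁`. [folklore] -/
theorem nsq_sdiff_cut_le (c : ℂ) (ν : Fin d) {ψ : Tor N → ℝ} {ℓ₁ : ℝ} (h0 : ∀ x, 0 ≤ ψ x) (h1 : ∀ x, ψ x ≤ 1)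
    (hlip : ∀ x, |ψ (x + unitVec N ν) - ψ x| ≤ ℓ₁) (z : Tor N → ℂ) :
    nsq (sdiff N c ν *ᵥ cut N ψ z) ≤ 2 * nsq (sdiff N c ν *ᵥ z) + 2 * ‖c‖ ^ 2 * ℓ₁ ^ 2 * nsq z := by
  rw [sdiff_cut]
  refine (nsq_add_le _ _).trans ?_
  have hA : nsq (cut N (fun x => ψ (x + unitVec N ν)) (sdiff N c ν *ᵥ z)) ≤ 1 ^ 2 * nsq (sdiff N c ν *ᵥ z) :=
    nsq_mul_le (fun x => norm_ofReal_le_one N h0 h1 (x + unitVec N ν)) _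
  have hB : nsq (c • (fun x => ((ψ (x + unitVec N ν) - ψ x : ℝ) : ℂ) * z x)) ≤ ‖c‖ ^ 2 * (ℓ₁ ^ 2 * nsq z) := by
    rw [nsq_smul]
    refine mul_le_mul_of_nonneg_left (nsq_mul_le (fun x => ?_) z) (sq_nonneg _)
    rw [Complex.norm_real, Real.norm_eq_abs]; exact hlip x
  nlinarith [hA, hB]

/-- the Dirichlet energy `E(z) = Σ_ν ‖∂_νz‖²`. [folklore] -/
def energy (c : ℂ) (z : Tor N → ℂ) : ℝ := ∑ ν, nsq (sdiff N c ν *ᵥ z)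

/-- `E(z) ≥ 0`. [folklore] -/
theorem energy_nonneg (c : ℂ) (z : Tor N → ℂ) : 0 ≤ energy N c z := Finset.sum_nonneg fun _ _ => nsq_nonneg _

/-- `‖∂_νz‖² ≤ E(z)`. [folklore] -/
theorem nsq_sdiff_le_energy (c : ℂ) (ν : Fin d) (z : Tor N → ℂ) : nsq (sdiff N c ν *ᵥ z) ≤ energy N c z :=
  Finset.single_le_sum (f := fun ν => nsq (sdiff N c ν *ᵥ z)) (fun _ _ => nsq_nonneg _) (Finset.mem_univ ν)

/-- **energy of a cut field**: `E(ψz) ≤ 2E(z) + 2d‖c‖²ℓ₁²‖z‖²`. [folklore] -/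
theorem energy_cut_le (c : ℂ) {ψ : Tor N → ℝ} {ℓ₁ : ℝ} (h0 : ∀ x, 0 ≤ ψ x) (h1 : ∀ x, ψ x ≤ 1)
    (hlip : ∀ x (ν : Fin d), |ψ (x + unitVec N ν) - ψ x| ≤ ℓ₁) (z : Tor N → ℂ) :
    energy N c (cut N ψ z) ≤ 2 * energy N c z + 2 * d * ‖c‖ ^ 2 * ℓ₁ ^ 2 * nsq z := by
  unfold energy
  calc ∑ ν, nsq (sdiff N c ν *ᵥ cut N ψ z) ≤ ∑ ν : Fin d, (2 * nsq (sdiff N c ν *ᵥ z) + 2 * ‖c‖ ^ 2 * ℓ₁ ^ 2 * nsq z) :=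
        Finset.sum_le_sum fun ν _ => nsq_sdiff_cut_le N c ν h0 h1 (fun x => hlip x ν) z
    _ = 2 * ∑ ν, nsq (sdiff N c ν *ᵥ z) + 2 * d * ‖c‖ ^ 2 * ℓ₁ ^ 2 * nsq z := by
        rw [Finset.sum_add_distrib, ← Finset.mul_sum, Finset.sum_const, Finset.card_univ, Fintype.card_fin]; ring

/-- **THE PRODUCT RULE FOR THE LAPLACIAN** (first and PURE second differences of `ψ` only):
`Δ(ψz) = ψ·Δz + Σ_ν |c|²·[ (ψ − T_{e_ν}ψ)·(T_{e_ν}z − T_{−e_ν}z) + (2ψ − T_{e_ν}ψ − T_{−e_ν}ψ)·T_{−e_ν}z ]`. [folklore] -/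
theorem LapS_cut (c : ℂ) (ψ : Tor N → ℝ) (z : Tor N → ℂ) :
    LapS N c *ᵥ cut N ψ z
      = cut N ψ (LapS N c *ᵥ z)
        + ∑ ν, (conj c * c) • ((fun x => ((ψ x - ψ (x + unitVec N ν) : ℝ) : ℂ) * (z (x + unitVec N ν) - z (x - unitVec N ν)))
            + (fun x => ((2 * ψ x - ψ (x + unitVec N ν) - ψ (x - unitVec N ν) : ℝ) : ℂ) * z (x - unitVec N ν))) := by
  funext x
  simp only [LapS_mulVec, cut, Pi.add_apply, Finset.sum_apply, Pi.smul_apply, smul_eq_mul, Complex.ofReal_sub,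
    Complex.ofReal_mul, Complex.ofReal_ofNat, Finset.mul_sum, ← Finset.sum_add_distrib]
  exact Finset.sum_congr rfl fun ν _ => by ring

/-- `T_{e_ν}z − T_{−e_ν}z = c⁻¹·(∂_νz + T_{−e_ν}∂_νz)`. [folklore] -/
theorem transl_sub_transl_eq (c : ℂ) (hc : c ≠ 0) (ν : Fin d) (z : Tor N → ℂ) :
    (fun x => z (x + unitVec N ν) - z (x - unitVec N ν))
      = c⁻¹ • (sdiff N c ν *ᵥ z + transS N (-unitVec N ν) (sdiff N c ν *ᵥ z)) := by
  funext x
  simp only [Pi.smul_apply, Pi.add_apply, smul_eq_mul, sdiff_mulVec, transS, ← sub_eq_add_neg, sub_add_cancel]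
  field_simp
  ring

/-- **the commutator bound**: for `0 ≤ ψ ≤ 1` with first ∕ pure second differences `≤ ℓ₁ ∕ ℓ₂` (`ℓ₁, ℓ₂ ≥ 0`, `c ≠ 0`),
`‖1_Ω·Δ(ψz)‖ ≤ ‖1_Ω·Δz‖ + Σ_ν (2‖c‖ℓ₁‖∂_νz‖ + ‖c‖²ℓ₂‖z‖)`. [folklore] -/
theorem sqrt_nsq_restrict_LapS_cut_le {Ω : Tor N → Prop} [DecidablePred Ω] (c : ℂ) (hc : c ≠ 0) {ψ : Tor N → ℝ} {ℓ₁ ℓ₂ : ℝ}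
    (hℓ₁ : 0 ≤ ℓ₁) (hℓ₂ : 0 ≤ ℓ₂) (h0 : ∀ x, 0 ≤ ψ x) (h1 : ∀ x, ψ x ≤ 1)
    (hlip : ∀ x (ν : Fin d), |ψ (x + unitVec N ν) - ψ x| ≤ ℓ₁)
    (hlip₂ : ∀ x (ν : Fin d), |2 * ψ x - ψ (x + unitVec N ν) - ψ (x - unitVec N ν)| ≤ ℓ₂) (z : Tor N → ℂ) :
    Real.sqrt (nsq (restrictTo Ω (LapS N c *ᵥ cut N ψ z)))
      ≤ Real.sqrt (nsqOn Ω (LapS N c *ᵥ z))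
        + ∑ ν, (2 * ‖c‖ * ℓ₁ * Real.sqrt (nsq (sdiff N c ν *ᵥ z)) + ‖c‖ ^ 2 * ℓ₂ * Real.sqrt (nsq z)) := by
  have hc0 : 0 < ‖c‖ := norm_pos_iff.mpr hc
  -- `1_Ω (ψ·Δz + S) = ψ·(1_Ω Δz) + 1_Ω S` pointwise, and `|1_Ω S| ≤ |S|`
  set S : Tor N → ℂ := ∑ ν, (conj c * c) • ((fun x => ((ψ x - ψ (x + unitVec N ν) : ℝ) : ℂ) * (z (x + unitVec N ν) - z (x - unitVec N ν)))
            + (fun x => ((2 * ψ x - ψ (x + unitVec N ν) - ψ (x - unitVec N ν) : ℝ) : ℂ) * z (x - unitVec N ν))) with hS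
  have hdec : restrictTo Ω (LapS N c *ᵥ cut N ψ z) = cut N ψ (restrictTo Ω (LapS N c *ᵥ z)) + restrictTo Ω S := by
    rw [LapS_cut, ← hS]
    funext x
    simp only [restrictTo, cut, Pi.add_apply]
    split_ifs <;> simp
  rw [hdec]
  refine (sqrt_nsq_add_le _ _).trans (add_le_add ?_ ?_)
  · -- `‖ψ·(1_Ω Δz)‖ ≤ ‖1_Ω Δz‖`
    calc Real.sqrt (nsq (cut N ψ (restrictTo Ω (LapS N c *ᵥ z)))) ≤ 1 * Real.sqrt (nsq (restrictTo Ω (LapS N c *ᵥ z))) :=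
          sqrt_nsq_mul_le zero_le_one (fun x => norm_ofReal_le_one N h0 h1 x) _
      _ = Real.sqrt (nsqOn Ω (LapS N c *ᵥ z)) := by rw [one_mul, nsq_restrictTo]
  · calc Real.sqrt (nsq (restrictTo Ω S)) ≤ Real.sqrt (nsq S) := sqrt_nsq_mono (norm_restrictTo_le Ω S)
      _ ≤ ∑ ν, Real.sqrt (nsq ((conj c * c) • ((fun x => ((ψ x - ψ (x + unitVec N ν) : ℝ) : ℂ)
              * (z (x + unitVec N ν) - z (x - unitVec N ν)))
            + (fun x => ((2 * ψ x - ψ (x + unitVec N ν) - ψ (x - unitVec N ν) : ℝ) : ℂ) * z (x - unitVec N ν))))) :=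
          sqrt_nsq_sum_le _ _
      _ ≤ ∑ ν, (2 * ‖c‖ * ℓ₁ * Real.sqrt (nsq (sdiff N c ν *ᵥ z)) + ‖c‖ ^ 2 * ℓ₂ * Real.sqrt (nsq z)) := by
          refine Finset.sum_le_sum fun ν _ => ?_
          rw [sqrt_nsq_smul, norm_mul, Complex.norm_conj, ← sq]
          have hα : Real.sqrt (nsq (fun x => ((ψ x - ψ (x + unitVec N ν) : ℝ) : ℂ) * (z (x + unitVec N ν) - z (x - unitVec N ν))))
              ≤ ℓ₁ * (‖c‖⁻¹ * (2 * Real.sqrt (nsq (sdiff N c ν *ᵥ z)))) := by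
            refine (sqrt_nsq_mul_le hℓ₁ (fun x => ?_) _).trans (mul_le_mul_of_nonneg_left ?_ hℓ₁)
            · rw [Complex.norm_real, Real.norm_eq_abs, abs_sub_comm]; exact hlip x ν
            · rw [transl_sub_transl_eq N c hc ν z, sqrt_nsq_smul, norm_inv]
              refine mul_le_mul_of_nonneg_left ((sqrt_nsq_add_le _ _).trans ?_) (inv_nonneg.mpr hc0.le)
              rw [nsq_transS, two_mul]
          have hβ : Real.sqrt (nsq (fun x => ((2 * ψ x - ψ (x + unitVec N ν) - ψ (x - unitVec N ν) : ℝ) : ℂ) * z (x - unitVec N ν)))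
              ≤ ℓ₂ * Real.sqrt (nsq z) := by
            refine (sqrt_nsq_mul_le hℓ₂ (fun x => ?_) _).trans (le_of_eq ?_)
            · rw [Complex.norm_real, Real.norm_eq_abs]; exact hlip₂ x ν
            · have : (fun x => z (x - unitVec N ν)) = transS N (-unitVec N ν) z := by
                funext x; simp [transS, sub_eq_add_neg]
              rw [this, nsq_transS]
          calc ‖c‖ ^ 2 * Real.sqrt (nsq ((fun x => ((ψ x - ψ (x + unitVec N ν) : ℝ) : ℂ) * (z (x + unitVec N ν) - z (x - unitVec N ν)))
                + (fun x => ((2 * ψ x - ψ (x + unitVec N ν) - ψ (x - unitVec N ν) : ℝ) : ℂ) * z (x - unitVec N ν))))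
              ≤ ‖c‖ ^ 2 * (ℓ₁ * (‖c‖⁻¹ * (2 * Real.sqrt (nsq (sdiff N c ν *ᵥ z)))) + ℓ₂ * Real.sqrt (nsq z)) :=
                mul_le_mul_of_nonneg_left ((sqrt_nsq_add_le _ _).trans (add_le_add hα hβ)) (sq_nonneg _)
            _ = 2 * ‖c‖ * ℓ₁ * Real.sqrt (nsq (sdiff N c ν *ᵥ z)) + ‖c‖ ^ 2 * ℓ₂ * Real.sqrt (nsq z) := by
                field_simp

/-! ## §5 Admissibility of the two cut pieces -/

omit hN in
/-- `ψz` may be translated by `+e_μ` inside `Ω`: `T_{e_μ}(ψz) − ψz` vanishes off `Ω` (for `z` supported in `Ω`). [folklore] -/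
theorem admissible_pos {Ω : Tor N → Prop} {μ : Fin d} {ψ : Tor N → ℝ} {ℓ₁ ℓ₂ : ℝ} (h : AdmissibleCutoff N Ω μ ψ ℓ₁ ℓ₂)
    {z : Tor N → ℂ} (hz : ∀ x, ¬ Ω x → z x = 0) :
    ∀ x, ¬ Ω x → (transS N (unitVec N μ) (cut N ψ z) - cut N ψ z) x = 0 := by
  intro x hx
  simp only [Pi.sub_apply, transS, cut, hz x hx, mul_zero, sub_zero]
  by_cases hy : Ω (x + unitVec N μ)
  · rw [h.zero_of _ hy (by rwa [add_sub_cancel_right]), Complex.ofReal_zero, zero_mul]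
  · rw [hz _ hy, mul_zero]

omit hN in
/-- `(1−ψ)z` may be translated by `−e_μ` inside `Ω`: `T_{−e_μ}((1−ψ)z) − (1−ψ)z` vanishes off `Ω`. [folklore] -/
theorem admissible_neg {Ω : Tor N → Prop} {μ : Fin d} {ψ : Tor N → ℝ} {ℓ₁ ℓ₂ : ℝ} (h : AdmissibleCutoff N Ω μ ψ ℓ₁ ℓ₂)
    {z : Tor N → ℂ} (hz : ∀ x, ¬ Ω x → z x = 0) :
    ∀ x, ¬ Ω x → (transS N (-unitVec N μ) (cut N (fun y => 1 - ψ y) z) - cut N (fun y => 1 - ψ y) z) x = 0 := by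
  intro x hx
  simp only [Pi.sub_apply, transS, cut, hz x hx, mul_zero, sub_zero, ← sub_eq_add_neg]
  by_cases hy : Ω (x - unitVec N μ)
  · rw [h.one_of _ hy (by rwa [sub_add_cancel]), sub_self, Complex.ofReal_zero, zero_mul]
  · rw [hz _ hy, mul_zero]

omit hN in
/-- the two pieces recompose: `ψz + (1−ψ)z = z`. [folklore] -/
theorem cut_add_cut_compl (ψ : Tor N → ℝ) (z : Tor N → ℂ) : cut N ψ z + cut N (fun y => 1 - ψ y) z = z := by
  funext x; simp only [cut, Pi.add_apply, Complex.ofReal_sub, Complex.ofReal_one]; ring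

/-! ## §6 THE END: directional Besov regularity up to the boundary -/

/-- **ONE CUT PIECE**: for `z` supported in `Ω` and a cutoff `φ` (`0 ≤ φ ≤ 1`, differences `≤ ℓ₁`, pure second differences `≤ ℓ₂`)
such that `T_v(φz) − φz` vanishes off `Ω` (`v = ±e_μ`):
`‖∂_μ∂_μ(φz)‖² ≤ 2‖c‖·√(2E(z) + 2d‖c‖²ℓ₁²‖z‖²)·(‖1_ΩΔz‖ + Σ_ν(2‖c‖ℓ₁‖∂_νz‖ + ‖c‖²ℓ₂‖z‖))`. [folklore] -/
theorem nsq_sdiff_sdiff_cut_le {Ω : Tor N → Prop} [DecidablePred Ω] (c : ℂ) (hc : c ≠ 0) (μ : Fin d) {v : Tor N}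
    (hv : v = unitVec N μ ∨ v = -unitVec N μ) {φ : Tor N → ℝ} {ℓ₁ ℓ₂ : ℝ} (hℓ₁ : 0 ≤ ℓ₁) (hℓ₂ : 0 ≤ ℓ₂)
    (h0 : ∀ x, 0 ≤ φ x) (h1 : ∀ x, φ x ≤ 1) (hlip : ∀ x (ν : Fin d), |φ (x + unitVec N ν) - φ x| ≤ ℓ₁)
    (hlip₂ : ∀ x (ν : Fin d), |2 * φ x - φ (x + unitVec N ν) - φ (x - unitVec N ν)| ≤ ℓ₂) (z : Tor N → ℂ)
    (hadm : ∀ x, ¬ Ω x → (transS N v (cut N φ z) - cut N φ z) x = 0) :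
    nsq (sdiff N c μ *ᵥ (sdiff N c μ *ᵥ cut N φ z))
      ≤ 2 * ‖c‖ * Real.sqrt (2 * energy N c z + 2 * d * ‖c‖ ^ 2 * ℓ₁ ^ 2 * nsq z)
          * (Real.sqrt (nsqOn Ω (LapS N c *ᵥ z))
              + ∑ ν, (2 * ‖c‖ * ℓ₁ * Real.sqrt (nsq (sdiff N c ν *ᵥ z)) + ‖c‖ ^ 2 * ℓ₂ * Real.sqrt (nsq z))) := by
  have hmain := nsq_sdiff_sdiff_le_of_admissible N c hc μ hv (cut N φ z) (restrictTo Ω (LapS N c *ᵥ cut N φ z)) hadm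
    (fun x hx => by simp [restrictTo, hx])
  have hE : Real.sqrt (∑ ν, nsq (sdiff N c ν *ᵥ cut N φ z)) ≤ Real.sqrt (2 * energy N c z + 2 * d * ‖c‖ ^ 2 * ℓ₁ ^ 2 * nsq z) :=
    Real.sqrt_le_sqrt (energy_cut_le N c h0 h1 hlip z)
  have hR := sqrt_nsq_restrict_LapS_cut_le N (Ω := Ω) c hc hℓ₁ hℓ₂ h0 h1 hlip hlip₂ z
  have hc0 : 0 ≤ 2 * ‖c‖ := by positivity
  calc nsq (sdiff N c μ *ᵥ (sdiff N c μ *ᵥ cut N φ z))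
      ≤ 2 * ‖c‖ * Real.sqrt (∑ ν, nsq (sdiff N c ν *ᵥ cut N φ z)) * Real.sqrt (nsq (restrictTo Ω (LapS N c *ᵥ cut N φ z))) := hmain
    _ ≤ 2 * ‖c‖ * Real.sqrt (2 * energy N c z + 2 * d * ‖c‖ ^ 2 * ℓ₁ ^ 2 * nsq z)
          * (Real.sqrt (nsqOn Ω (LapS N c *ᵥ z))
              + ∑ ν, (2 * ‖c‖ * ℓ₁ * Real.sqrt (nsq (sdiff N c ν *ᵥ z)) + ‖c‖ ^ 2 * ℓ₂ * Real.sqrt (nsq z))) :=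
        mul_le_mul (mul_le_mul_of_nonneg_left hE hc0) hR (Real.sqrt_nonneg _) (mul_nonneg hc0 (Real.sqrt_nonneg _))

/-- **DIRECTIONAL BESOV REGULARITY UP TO THE BOUNDARY (the END of module (I))**: for EVERY lattice field `z` supported in `Ω` and
every axis `μ` carrying an admissible cutoff `ψ` (`AdmissibleCutoff Ω μ ψ ℓ₁ ℓ₂`),
`‖∂_μ∂_μ z‖² ≤ 8‖c‖ · √(2E(z) + 2d‖c‖²ℓ₁²‖z‖²) · ( √(Σ_{x∈Ω}|(Δz)(x)|²) + Σ_ν (2‖c‖ℓ₁‖∂_νz‖ + ‖c‖²ℓ₂‖z‖) )`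
— the pure second differences of `z` over the WHOLE torus (boundary layers included) are controlled by the Dirichlet energy, the mass
and the COMPRESSED Laplacian of `z`, at the cost of ONE factor `‖c‖` (with `ℓ₁ ~ c⁻¹`, `ℓ₂ ~ c⁻²`); no convexity of `Ω`. [folklore] -/
theorem nsq_sdiff_sdiff_le {Ω : Tor N → Prop} [DecidablePred Ω] {μ : Fin d} {ψ : Tor N → ℝ} {ℓ₁ ℓ₂ : ℝ}
    (hψ : AdmissibleCutoff N Ω μ ψ ℓ₁ ℓ₂) (c : ℂ) (hc : c ≠ 0) {z : Tor N → ℂ} (hz : ∀ x, ¬ Ω x → z x = 0) :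
    nsq (sdiff N c μ *ᵥ (sdiff N c μ *ᵥ z))
      ≤ 8 * ‖c‖ * Real.sqrt (2 * energy N c z + 2 * d * ‖c‖ ^ 2 * ℓ₁ ^ 2 * nsq z)
          * (Real.sqrt (nsqOn Ω (LapS N c *ᵥ z))
              + ∑ ν, (2 * ‖c‖ * ℓ₁ * Real.sqrt (nsq (sdiff N c ν *ᵥ z)) + ‖c‖ ^ 2 * ℓ₂ * Real.sqrt (nsq z))) := by
  classical
  have x0 : Tor N := fun _ => 0
  have hℓ₁ : 0 ≤ ℓ₁ := hψ.ell1_nonneg x0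
  have hℓ₂ : 0 ≤ ℓ₂ := hψ.ell2_nonneg x0
  obtain ⟨c0, c1, clip, clip₂⟩ := hψ.compl_bounds
  -- the two admissible pieces
  have hP := nsq_sdiff_sdiff_cut_le N (Ω := Ω) c hc μ (Or.inl rfl) hℓ₁ hℓ₂ hψ.nonneg hψ.le_one hψ.lip hψ.lip₂ z
    (admissible_pos N hψ hz)
  have hM := nsq_sdiff_sdiff_cut_le N (Ω := Ω) c hc μ (Or.inr rfl) hℓ₁ hℓ₂ c0 c1 clip clip₂ z (admissible_neg N hψ hz)
  -- recombine `z = ψz + (1−ψ)z`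
  have hsplit : sdiff N c μ *ᵥ (sdiff N c μ *ᵥ z)
      = sdiff N c μ *ᵥ (sdiff N c μ *ᵥ cut N ψ z) + sdiff N c μ *ᵥ (sdiff N c μ *ᵥ cut N (fun y => 1 - ψ y) z) := by
    rw [← Matrix.mulVec_add, ← Matrix.mulVec_add, cut_add_cut_compl]
  rw [hsplit]
  refine (nsq_add_le _ _).trans ?_
  linarith

/-- the same bound for the ADJOINT-SANDWICH form `∂_μᴴ∂_μ z` (`‖∂_μᴴ∂_μ z‖ = ‖∂_μ∂_μ z‖`: the stencil of `∂_μᴴ∂_μ` at `x` is the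
stencil of `∂_μ∂_μ` at `x − e_μ` up to the unimodular factor `−c̄/c`) — the quantity the two-level pairing bound (C-glob) consumes.
[folklore] -/
theorem nsq_sdiffH_sdiff_eq (c : ℂ) (hc : c ≠ 0) (μ : Fin d) (z : Tor N → ℂ) :
    nsq ((sdiff N c μ)ᴴ *ᵥ (sdiff N c μ *ᵥ z)) = nsq (sdiff N c μ *ᵥ (sdiff N c μ *ᵥ z)) := by
  have hpt : ∀ x, ((sdiff N c μ)ᴴ *ᵥ (sdiff N c μ *ᵥ z)) x
      = -(conj c * c⁻¹) * (sdiff N c μ *ᵥ (sdiff N c μ *ᵥ z)) (x - unitVec N μ) := by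
    intro x
    simp only [Literature.MathematicalPhysics.QuantumFieldTheory.Balaban1983to89.B5Action121.sdiff_conjTranspose_mulVec,
      sdiff_mulVec, sub_add_cancel]
    field_simp
    ring
  have hT : (fun x => (sdiff N c μ *ᵥ (sdiff N c μ *ᵥ z)) (x - unitVec N μ))
      = transS N (-unitVec N μ) (sdiff N c μ *ᵥ (sdiff N c μ *ᵥ z)) := by
    funext x; simp [transS, sub_eq_add_neg]
  calc nsq ((sdiff N c μ)ᴴ *ᵥ (sdiff N c μ *ᵥ z))
      = nsq ((-(conj c * c⁻¹)) • fun x => (sdiff N c μ *ᵥ (sdiff N c μ *ᵥ z)) (x - unitVec N μ)) := by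
        congr 1; funext x; rw [hpt x]; rfl
    _ = nsq (sdiff N c μ *ᵥ (sdiff N c μ *ᵥ z)) := by
        rw [nsq_smul, norm_neg, norm_mul, Complex.norm_conj, norm_inv, mul_inv_cancel₀ (norm_ne_zero_iff.mpr hc), one_pow,
          one_mul, hT, nsq_transS]

/-- **THE END, adjoint-sandwich form**: `‖∂_μᴴ∂_μ z‖² ≤` the same right-hand side. [folklore] -/
theorem nsq_sdiffH_sdiff_le {Ω : Tor N → Prop} [DecidablePred Ω] {μ : Fin d} {ψ : Tor N → ℝ} {ℓ₁ ℓ₂ : ℝ}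
    (hψ : AdmissibleCutoff N Ω μ ψ ℓ₁ ℓ₂) (c : ℂ) (hc : c ≠ 0) {z : Tor N → ℂ} (hz : ∀ x, ¬ Ω x → z x = 0) :
    nsq ((sdiff N c μ)ᴴ *ᵥ (sdiff N c μ *ᵥ z))
      ≤ 8 * ‖c‖ * Real.sqrt (2 * energy N c z + 2 * d * ‖c‖ ^ 2 * ℓ₁ ^ 2 * nsq z)
          * (Real.sqrt (nsqOn Ω (LapS N c *ᵥ z))
              + ∑ ν, (2 * ‖c‖ * ℓ₁ * Real.sqrt (nsq (sdiff N c ν *ᵥ z)) + ‖c‖ ^ 2 * ℓ₂ * Real.sqrt (nsq z))) := by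
  rw [nsq_sdiffH_sdiff_eq N c hc]
  exact nsq_sdiff_sdiff_le N hψ c hc hz

end Torus

end Summit.QuantumFields.BalabanUV.T4Continuum.DirichletDirectionalBesovCutoff

end
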